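import Literature.AlgebraicGeometry.Frobenioids.DivisorMonoidCategoryTheoreticityThm42
import Literature.AlgebraicGeometry.Frobenioids.EquivalencePreStepsFSMFF2024
import HarnessLib

/-!
# Frobenioids I, Theorem 4.2 (ii), (iii) AS TYPED over bases of FSMFF-type in the author's REVISED (2024) sense:
# the pre-step hypotheses discharged by Theorem 3.4 (ii) over such bases

Mochizuki, *The geometry of Frobenioids I: the general theory*, Kyushu J. Math. **62** (2008)
293–400, §4, Theorem 4.2 (ii)(iii), kurims pp. 77–81 [cite: MochizukiFrdI2008, Thm. 4.2 (ii) p.77], with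
Theorem 3.4 (ii) p. 62 ("`Ψ` preserves pre-steps"); condition (b) of "FSMFF-type" as revised in the author's
*Comments* (January 2024), item (28) [cite: MochizukiFrdIComments2024, (28) p.3].

PROOF-ONLY file (seat abc-iut-w4-d088; downstream of GAP-LEDGER row G-L1d8-1, per abc-iut-L1-lead R100 (1)):
the twin, over the WIDER class of bases of FSMFF-type in the revised sense (⊋ FSM-type), of
`DivisorMonoidCategoryTheoreticityThm42FSM.lean` (abc-iut-L1-t14 / w4-d090) — the hypotheses "`Ψ`, `Ψ⁻¹` preserve
(pre-)steps" of abc-iut-L1-t14's `thm42ii_of_perfectType` / `thm42iii_of` are DISCHARGED by abc-iut-L1-t11's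
kernel proof of Thm. 3.4 (ii) over FSMFF-type (revised) bases (`FrdI.isPreStep_map_of_isOfFSMFFType2024`, the
printed route through the revised Prop. 1.14 (iii)), leaving exactly the residual inputs of the FSM-type file:
for (ii) perfect type + "`Ψ`, `Ψ⁻¹` preserve primary pre-steps" [Thm. 4.2 (i)]; for (iii) "`Ψ` preserves Frobenius
type, degrees [Thm. 3.4 (iii)], Div-identity endomorphisms [Thm. 4.2 (i)]" + the (ii)-clauses for `e`. No new
definition; no statement of the paper is restated or strengthened.
-/

namespace Literature.AlgebraicGeometry.Frobenioids

open CategoryTheory Opposite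

namespace PreFrobenioidData

universe w v v' u u'

variable {D : Type u} [Category.{v} D] {Φ : Dᵒᵖ ⥤ CommMonCat.{w}} {C : Type u'} [Category.{v'} C]
  {F : C ⥤ ElemFrobenioid Φ}
variable {D₂ : Type u} [Category.{v} D₂] {Φ₂ : D₂ᵒᵖ ⥤ CommMonCat.{w}} {C₂ : Type u'}
  [Category.{v'} C₂] {F₂ : C₂ ⥤ ElemFrobenioid Φ₂} (Ψ : C ≌ C₂)

/-- Over bases of FSMFF-type (revised) and Frobenioids of isotropic type, `Ψ` preserves steps (Thm. 3.4 (ii) over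
such bases, abc-iut-L1-t11, + reflection of isomorphisms). [cite: MochizukiFrdI2008, Thm. 3.4 (ii) p.62] -/
theorem isStep_map_of_isOfFSMFFType2024 (hF : PreFrobenioid.IsFrobenioid F) (hF₂ : PreFrobenioid.IsFrobenioid F₂)
    (hi : PreFrobenioid.IsOfIsotropicType F) (hi₂ : PreFrobenioid.IsOfIsotropicType F₂)
    (hD : IsOfFSMFFType2024 D) (hD₂ : IsOfFSMFFType2024 D₂) {X Y : C} {φ : X ⟶ Y}
    (hφ : PreFrobenioid.IsStep F φ) : PreFrobenioid.IsStep F₂ (Ψ.functor.map φ) :=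
  ⟨FrdI.isPreStep_map_of_isOfFSMFFType2024 hF hF₂ hi hi₂ hD hD₂ Ψ hφ.1, fun h => hφ.2
    (by haveI := h; exact Ψ.fullyFaithfulFunctor.isIso_of_isIso_map φ)⟩

/-- **Theorem 4.2 (ii) as typed, perfect-type case over FSMFF-type (revised) bases, conditional only on
Thm. 4.2 (i)** ("`Ψ`, `Ψ⁻¹` preserve primary pre-steps"). [cite: MochizukiFrdI2008, Thm. 4.2 (ii) p.77]
[cite: MochizukiFrdIComments2024, (28) p.3] -/
theorem thm42ii_of_perfectType_of_isOfFSMFFType2024 (hF : PreFrobenioid.IsFrobenioid F)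
    (hF₂ : PreFrobenioid.IsFrobenioid F₂)
    (hperf : PreFrobenioid.IsOfPerfectType F) (hperf₂ : PreFrobenioid.IsOfPerfectType F₂)
    (hpf : Objectwise (fun M _ => IsPerfFactorial M) Φ)
    (hpf₂ : Objectwise (fun M _ => IsPerfFactorial M) Φ₂)
    (hD : IsOfFSMFFType2024 D) (hD₂ : IsOfFSMFFType2024 D₂)
    (hprim : ∀ ⦃X Y : C⦄ (φ : X ⟶ Y), PreFrobenioid.IsPrimaryPreStep F φ →
      PreFrobenioid.IsPrimaryPreStep F₂ (Ψ.functor.map φ))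
    (hprim' : ∀ ⦃X Y : C₂⦄ (φ : X ⟶ Y), PreFrobenioid.IsPrimaryPreStep F₂ φ →
      PreFrobenioid.IsPrimaryPreStep F (Ψ.inverse.map φ)) :
    (ofFunctor Φ F).Thm42ii (ofFunctor Φ₂ F₂) Ψ := by
  intro hS
  have histr := (ofFunctor_isOfIsotropicType F).mp hS.isotropic.1
  have histr₂ := (ofFunctor_isOfIsotropicType F₂).mp hS.isotropic.2
  exact thm42ii_of_perfectType Ψ hF hF₂ hperf hperf₂ hpf hpf₂
    (fun X Y φ hφ => isStep_map_of_isOfFSMFFType2024 Ψ hF hF₂ histr histr₂ hD hD₂ hφ)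
    (fun X Y φ hφ => isStep_map_of_isOfFSMFFType2024 Ψ.symm hF₂ hF histr₂ histr hD₂ hD hφ)
    (fun X Y φ hφ => FrdI.isPreStep_map_of_isOfFSMFFType2024 hF hF₂ histr histr₂ hD hD₂ Ψ hφ)
    (fun X Y φ hφ => FrdI.isPreStep_map_of_isOfFSMFFType2024 hF₂ hF histr₂ histr hD₂ hD Ψ.symm hφ)
    hprim hprim' hS

/-- **Theorem 4.2 (iii) as typed over FSMFF-type (revised) bases**, conditional on Thm. 3.4 (iii) ("`Ψ` preserves
Frobenius type and degrees"), Thm. 4.2 (i) ("`Ψ` preserves Div-identity endomorphisms") and the conclusion of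
Thm. 4.2 (ii) for the family `e`. [cite: MochizukiFrdI2008, Thm. 4.2 (iii) p.78] [cite: MochizukiFrdIComments2024, (28) p.3] -/
theorem thm42iii_of_isOfFSMFFType2024 (hF : PreFrobenioid.IsFrobenioid F) (hF₂ : PreFrobenioid.IsFrobenioid F₂)
    (hpf : Objectwise (fun M _ => IsPerfFactorial M) Φ)
    (hpf₂ : Objectwise (fun M _ => IsPerfFactorial M) Φ₂)
    (hD : IsOfFSMFFType2024 D) (hD₂ : IsOfFSMFFType2024 D₂)
    (hfrob : ∀ ⦃X Y : C⦄ (φ : X ⟶ Y), PreFrobenioid.IsFrobeniusType F φ →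
      PreFrobenioid.IsFrobeniusType F₂ (Ψ.functor.map φ))
    (hdeg : ∀ ⦃X Y : C⦄ (φ : X ⟶ Y), PreFrobenioid.degFr F₂ (Ψ.functor.map φ) = PreFrobenioid.degFr F φ)
    (hdivid : ∀ (A : C) (α : A ⟶ A), PreFrobenioid.IsDivIdentity F α →
      PreFrobenioid.IsDivIdentity F₂ (Ψ.functor.map α))
    (e : ∀ A : C, Primes (Φ.obj (op (PreFrobenioid.baseObj F A))) ≃
      Primes (Φ₂.obj (op (PreFrobenioid.baseObj F₂ (Ψ.functor.obj A)))))
    (he : ∀ (A : C) (𝔭 : Primes (Φ.obj (op (PreFrobenioid.baseObj F A)))),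
      (∀ ⦃B : C⦄ (φ : A ⟶ B), PreFrobenioid.IsCoAngularPreStep F φ →
          (PreFrobenioid.Div F φ ∈ 𝔭.submonoid ↔
            PreFrobenioid.Div F₂ (Ψ.functor.map φ) ∈ (e A 𝔭).submonoid)) ∧
        ∀ ⦃B : C⦄ (ψ : B ⟶ A), PreFrobenioid.IsCoAngularPreStep F ψ →
          ((∃ y ∈ 𝔭.submonoid, Frobenioids.pull Φ (PreFrobenioid.Base F ψ) y = PreFrobenioid.Div F ψ) ↔
            ∃ y ∈ (e A 𝔭).submonoid, Frobenioids.pull Φ₂ (PreFrobenioid.Base F₂ (Ψ.functor.map ψ)) y =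
              PreFrobenioid.Div F₂ (Ψ.functor.map ψ))) :
    (ofFunctor Φ F).Thm42iii (ofFunctor Φ₂ F₂) Ψ e := by
  intro hS
  have histr := (ofFunctor_isOfIsotropicType F).mp hS.isotropic.1
  have histr₂ := (ofFunctor_isOfIsotropicType F₂).mp hS.isotropic.2
  exact thm42iii_of Ψ hF hF₂ hpf hpf₂
    (fun X Y φ hφ => FrdI.isPreStep_map_of_isOfFSMFFType2024 hF hF₂ histr histr₂ hD hD₂ Ψ hφ)
    (fun X Y φ hφ => FrdI.isPreStep_map_of_isOfFSMFFType2024 hF₂ hF histr₂ histr hD₂ hD Ψ.symm hφ)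
    hfrob hdeg hdivid e he hS

end PreFrobenioidData

end Literature.AlgebraicGeometry.Frobenioids
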